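import Literature.AlgebraicTopology.SingularHomology.ProductKunnethField
import Literature.AlgebraicGeometry.HodgeTheory.GysinBaseChangeOfKunneth
import Literature.AlgebraicGeometry.HodgeTheory.VanishingCohomologyNontrivialProofs
import Literature.AlgebraicGeometry.Motives.AlgPointsProductProofs
import Literature.AlgebraicGeometry.Motives.ComplexPointsManifold
import HarnessLib

/-!
# The Künneth theorem for `H*((Y ⊗ Z)(ℂ); ℂ)`, bijective form, and Betti numbers of products (proved)

A. Hatcher, *Algebraic Topology* (2002), §3.2 Thm. 3.16 with Cor. A.12 (Künneth over a field for
`X(ℂ) × Y(ℂ)`). The SPANNING half for the complex points of smooth projective varieties is the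
tree's `kunnethSpan_complexBetti` (`HodgeTheory/GysinBaseChange`, from
`SingularHomology/KunnethFormula`); this file adds the UNIQUENESS half and the dimension count,
from the graded-basis form of the Künneth theorem (`SingularHomology/ProductKunneth(Field)`,
`LerayHirsch.bijective_lhMap_fst_prod`, Leray–Hirsch for `pr₁`) transported along
`(Y ⊗ Z)(ℂ) ≃ₜ Y(ℂ) × Z(ℂ)` (the tree's proved `Motives.AlgPoints.continuous_prodEquiv(_symm)`,
Conrad 2012 Prop. 2.1 / Mumford I §10). For smooth projective `Y` (any `Z` in the first item):

* **`complexBetti_lhMap_bijective`** — for classes `eⱼ ∈ H^{d j}(Z(ℂ); ℂ)` forming a graded basis in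
  the Leray–Hirsch sense, `(aⱼ) ↦ Σⱼ fst^* aⱼ ∪ snd^* eⱼ : Π_{d j ≤ k} H^{k-d j}(Y(ℂ)) → Hᵏ((Y ⊗ Z)(ℂ))`
  is bijective for every `k` (`H*((Y ⊗ Z)(ℂ))` is a free `H*(Y(ℂ))`-module on the `snd^* eⱼ`);
* **`complexBetti_kunneth_bijective`** — the same for honest bases `b j` of the `Hʲ(Z(ℂ); ℂ)`,
  `j ≤ 2 dim Z` (`Z` smooth projective; uniqueness of the Künneth expansion);
* **`finrank_complexBetti_tensor`** — the Betti numbers multiply: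
  `b_k(Y ⊗ Z) = Σ_{j ≤ k} b_{k-j}(Y) · b_j(Z)`.

Everything is proved; no named facts.

## References

* [HatcherAT2002] A. Hatcher, Algebraic Topology, CUP 2002, §3.2 Thm. 3.15–3.16, Cor. A.12.
* [ConradAdelicPoints2012] B. Conrad, Weil and Grothendieck approaches to adelic points,
  Enseign. Math. 58 (2012), Prop. 2.1, Prop. 3.1.
-/

noncomputable section

open CategoryTheory AlgebraicGeometry MonoidalCategory CartesianMonoidalCategory
open Literature.AlgebraicGeometry.Motives
open Literature.AlgebraicTopology.SingularHomology

namespace Literature.AlgebraicGeometry.HodgeTheory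

variable {l m n : ℕ} {X Y Z : SchemeOver ℂ}

/-- **The Künneth theorem for `H*((Y ⊗ Z)(ℂ); ℂ)`, bijective form** (Hatcher Thm. 3.16 read through
`(Y ⊗ Z)(ℂ) ≃ₜ Y(ℂ) × Z(ℂ)`): for smooth projective `Y`, `Z` and classes `eⱼ ∈ H^{d j}(Z(ℂ); ℂ)`
forming a graded basis in the Leray–Hirsch sense (over the one-point base the comparison map is
bijective, e.g. bases of the `Hʲ(Z(ℂ); ℂ)`, `LerayHirsch.bijective_lhMap_const_of_basis`), the map
`(aⱼ) ↦ Σⱼ fst^* aⱼ ∪ snd^* eⱼ : Π_{d j ≤ k} H^{k - d j}(Y(ℂ)) → Hᵏ((Y ⊗ Z)(ℂ))` is bijective for every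
`k` — `H*((Y ⊗ Z)(ℂ))` is a free `H*(Y(ℂ))`-module on the `snd^* eⱼ`.
[cite: HatcherAT2002, §3.2 Thm. 3.16 with Cor. A.12] -/
theorem complexBetti_lhMap_bijective (hY : IsSmoothProjective m Y)
    {ι : Type} [Fintype ι] (d : ι → ℕ) (e : (j : ι) → complexBetti Z (d j))
    (he : ∀ k, Function.Bijective (LerayHirsch.lhMap ℂ d
      (ContinuousMap.const (ComplexPoints Z) PUnit.unit : C(ComplexPoints Z, PUnit.{1})) e k)) (k : ℕ) :
    Function.Bijective (LerayHirsch.lhMap ℂ d (AlgPoints.mapContinuous (L := ℂ) (fst Y Z))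
      (fun j ↦ complexBetti.map (snd Y Z) (d j) (e j)) k) := by
  letI := hY.chartedSpace
  haveI := ComplexPoints.compactSpace_of_isSmoothProjective hY
  haveI := ComplexPoints.t2Space_of_isSmoothProjective hY
  let T : ComplexPoints (Y ⊗ Z) ≃ₜ ComplexPoints Y × ComplexPoints Z :=
    Homeomorph.mk AlgPoints.prodEquiv AlgPoints.continuous_prodEquiv AlgPoints.continuous_prodEquiv_symm
  let Tc : C(ComplexPoints (Y ⊗ Z), ComplexPoints Y × ComplexPoints Z) := T
  have hfst : (ContinuousMap.fst : C(ComplexPoints Y × ComplexPoints Z, ComplexPoints Y)).comp Tc =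
      (ContinuousMap.id _).comp (AlgPoints.mapContinuous (L := ℂ) (fst Y Z)) := by
    ext P; rfl
  have hsnd : (ContinuousMap.snd : C(ComplexPoints Y × ComplexPoints Z, ComplexPoints Z)).comp Tc =
      AlgPoints.mapContinuous (L := ℂ) (snd Y Z) := by
    ext P; rfl
  have h := (LerayHirsch.bijective_lhMap_iff ℂ d _ _ Tc (ContinuousMap.id _) hfst
    (fun j ↦ singularCohomology.map ℂ ℂ (ContinuousMap.snd : C(ComplexPoints Y × ComplexPoints Z, ComplexPoints Z))
      (d j) (e j))
    (fun i ↦ (singularCohomology.mapIso ℂ ℂ T i).toLinearEquiv.bijective)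
    (fun i ↦ (singularCohomology.mapIso ℂ ℂ (Homeomorph.refl (ComplexPoints Y)) i).toLinearEquiv.bijective) k).1
    (LerayHirsch.bijective_lhMap_fst_prod ℂ d e (EuclideanSpace ℝ (Fin (2 * m))) (M := ComplexPoints Y) he k)
  have hcls : (fun j ↦ singularCohomology.map ℂ ℂ Tc (d j) (singularCohomology.map ℂ ℂ
      (ContinuousMap.snd : C(ComplexPoints Y × ComplexPoints Z, ComplexPoints Z)) (d j) (e j))) =
      fun j ↦ complexBetti.map (snd Y Z) (d j) (e j) := by
    funext j
    rw [← ModuleCat.comp_apply, ← singularCohomology.map_comp, hsnd]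
  rwa [hcls] at h

/-- **Künneth for `H*((Y ⊗ Z)(ℂ); ℂ)` with honest bases**: for bases `b j` of the
`Hʲ(Z(ℂ); ℂ)`, `j ≤ 2 dim Z` (they exist: `finite_complexBetti`), every class of `Hᵏ((Y ⊗ Z)(ℂ); ℂ)`
is `Σ_{j,i} fst^* a_{j,i} ∪ snd^* (b j i)` for a UNIQUE family `(a_{j,i} ∈ H^{k-j}(Y(ℂ)))_{j ≤ k}` — the
comparison map indexed by `Σ j, σ j` is bijective (`Hʲ(Z(ℂ)) = 0` for `j > 2 dim Z`).
[cite: HatcherAT2002, §3.2 Thm. 3.16 with Cor. A.12] -/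
theorem complexBetti_kunneth_bijective (hY : IsSmoothProjective m Y) (hZ : IsSmoothProjective n Z)
    {σ : Fin (2 * n + 1) → Type} [∀ j, Fintype (σ j)] (b : (j : Fin (2 * n + 1)) → Module.Basis (σ j) ℂ (complexBetti Z j))
    (k : ℕ) :
    Function.Bijective (LerayHirsch.lhMap ℂ (fun j : (Σ j, σ j) ↦ (j.1 : ℕ))
      (AlgPoints.mapContinuous (L := ℂ) (fst Y Z))
      (fun j ↦ complexBetti.map (snd Y Z) j.1 (b j.1 j.2)) k) := by
  refine complexBetti_lhMap_bijective hY _ (fun j : (Σ j, σ j) ↦ b j.1 j.2) ?_ k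
  refine LerayHirsch.bijective_lhMap_const_of_basis ℂ (fun j i ↦ b j i) (fun j ↦ ?_)
    (fun j hj ↦ subsingleton_complexBetti hZ hj)
  have : (fun r : σ j → ℂ ↦ ∑ i, r i • b j i) = (b j).equivFun.symm :=
    funext fun r ↦ ((b j).equivFun_symm_apply r).symm
  rw [this]
  exact (b j).equivFun.symm.bijective

/-- **Betti numbers of a product**: `b_k((Y ⊗ Z)(ℂ)) = Σ_{j ≤ k} b_{k-j}(Y(ℂ)) · b_j(Z(ℂ))` for smooth
projective `Y`, `Z` (the dimension count of the Künneth theorem, Hatcher Thm. 3.16 / Cor. 3.17-style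
consequence). [cite: HatcherAT2002, §3.2 Thm. 3.16] -/
theorem finrank_complexBetti_tensor (hY : IsSmoothProjective m Y) (hZ : IsSmoothProjective n Z) (k : ℕ) :
    Module.finrank ℂ (complexBetti (Y ⊗ Z) k) =
      ∑ j ∈ Finset.range (k + 1), Module.finrank ℂ (complexBetti Y (k - j)) * Module.finrank ℂ (complexBetti Z j) := by
  classical
  haveI := fun i ↦ finite_complexBetti hY i
  haveI := fun j ↦ finite_complexBetti hZ j
  -- the Künneth equivalence with the standard bases of `H*(Z(ℂ))`
  let c : Fin (2 * n + 1) → ℕ := fun j ↦ Module.finrank ℂ (complexBetti Z j)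
  let d : (Σ j : Fin (2 * n + 1), Fin (c j)) → ℕ := fun j ↦ (j.1 : ℕ)
  have hbij := complexBetti_kunneth_bijective hY hZ (fun j ↦ Module.finBasis ℂ (complexBetti Z j)) k
  rw [← (LinearEquiv.ofBijective _ hbij).finrank_eq, Module.finrank_pi_fintype]
  -- count: `Σ_{d j ≤ k} b_{k - d j}(Y) = Σ_{j ≤ 2n, j ≤ k} c j · b_{k-j}(Y)`
  have h1 : ∑ j : LerayHirsch.Idx d k, Module.finrank ℂ (complexBetti Y (k - d j.1)) =
      ∑ j ∈ Finset.range (2 * n + 1), if j ≤ k then Module.finrank ℂ (complexBetti Y (k - j)) * Module.finrank ℂ (complexBetti Z j) else 0 := by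
    rw [← Finset.sum_subtype (Finset.univ.filter fun j ↦ d j ≤ k) (fun j ↦ by simp)
      (fun j ↦ Module.finrank ℂ (complexBetti Y (k - d j))), Finset.sum_filter, Fintype.sum_sigma,
      ← Fin.sum_univ_eq_sum_range (fun j ↦ if j ≤ k then Module.finrank ℂ (complexBetti Y (k - j)) * Module.finrank ℂ (complexBetti Z j) else 0)]
    refine Finset.sum_congr rfl fun j _ ↦ ?_
    change ∑ i : Fin (c j), (if (j : ℕ) ≤ k then Module.finrank ℂ (complexBetti Y (k - j)) else 0) = _
    rw [Finset.sum_const, Finset.card_univ, Fintype.card_fin, smul_eq_mul]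
    split_ifs <;> simp [c, mul_comm]
  rw [h1]
  -- both sides are `Σ_{j < L} g j` for `g j = [j ≤ k] b_{k-j}(Y) b_j(Z)`, `b_j(Z) = 0` for `j > 2n`
  have hvan : ∀ j, 2 * n < j → Module.finrank ℂ (complexBetti Z j) = 0 := fun j hj ↦ by
    haveI := subsingleton_complexBetti hZ hj
    exact Module.finrank_zero_of_subsingleton
  set L := max (2 * n + 1) (k + 1)
  trans ∑ j ∈ Finset.range L, if j ≤ k then Module.finrank ℂ (complexBetti Y (k - j)) * Module.finrank ℂ (complexBetti Z j) else 0
  · refine Finset.sum_subset (Finset.range_mono (le_max_left _ _)) fun j _ hj ↦ ?_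
    rw [Finset.mem_range, not_lt] at hj
    rw [hvan j (by omega), mul_zero, ite_self]
  · symm
    refine (Finset.sum_congr rfl fun j hj ↦ ?_).trans (Finset.sum_subset (Finset.range_mono (le_max_right _ _)) fun j _ hj ↦ ?_)
    · rw [if_pos (Nat.lt_succ_iff.1 (Finset.mem_range.1 hj))]
    · rw [Finset.mem_range, not_lt] at hj
      rw [if_neg (by omega)]

end Literature.AlgebraicGeometry.HodgeTheory

end
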